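/-
COR-CM (cell pub-hodgecm2 = stage 2 of the Hodge ladder; stage-1 binder seat binder-2 gen 23, 2026-08-21; count-neutral:
no BINDER-OWNERS row, no E term, no display of record; `Interfaces.lean` (C1), `B01/*`, `Assembly/*` untouched; wording
of record untouched).  Supply for TRANSPOSITION item (vi) ∕ S2-crux (M-Sh): the component levels of `Sh_K(ℂ) = ⊔ Γ_g\𝔹²`.
-/
import Summits.HodgeConjecture.CorCM.CM.Basic
import Literature.NumberTheory.Automorphic.UnitaryGroupConjugateLevelTorsionFree
import Literature.NumberTheory.Automorphic.AdelicDoubleQuotientDissectionFinite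
import HarnessLib

/-!
# COR-CM — conjugate levels: every component `Γ_g\𝔹²` of `Sh_K(ℂ)`, `K ≤ K_f(n)`, `n ≥ 3`, sits at a `Level V`

For a hermitian 3-space `(V₃,h)` over the CM field `L` (`CorCM/CM/Basic.lean`), a `Level V` is a PAIR
`(Γ, K)` — a compact open `K ≤ U(V₃,h)(𝔸_{L⁺,f})` and the arithmetic group `Γ = U(V₃,h)(L⁺) ∩ K`, REQUIRED to be
torsion-free.  The complex points of the level-`K` Shimura variety of `Res U(V₃,h)` are the finite disjoint union
`Sh_K(ℂ) = ⊔_{[g] ∈ G(ℚ)\G(𝔸_f)/K} Γ_g\𝔹²`, `Γ_g = G(ℚ) ∩ gKg⁻¹` ([Milne 2005, Lemma 5.13]; [Getz–Hahn 2024, (15.2)]);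
to speak of the components as Picard modular surfaces `P_{Γ_g}(V)` of a universe (`Universe.pms L ι₁ V Γ`,
`Γ : Level V`) one needs EVERY `(Γ_g, gKg⁻¹)` to be a `Level V`, i.e. every `Γ_g` torsion-free.  The stage-1 pin
of [Liu 2021, Thm 4.18] (x1 `Thm418PinG`, fields `level : Comp K → Level V`, `level_conj`) POSITS these levels; this
file CONSTRUCTS them for `K ≤ K_f(n𝓞_L)`, `n ≥ 3`, from the Literature theorem
`UnitaryGroup.torsionFree_arithmeticLevel_map_conj` (`UnitaryGroupConjugateLevelTorsionFree`, htheta-x1: `U(J)(F) ∩ gKg⁻¹`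
is torsion-free — Minkowski's lemma for the integral residue `n⁻¹(γ - 1)`; packaged with compact-open-ness of
`gKg⁻¹` as `UnitaryGroup.isCompact_isOpen_torsionFree_map_conj`):

* §0 `mem_map_conj_iff` (`x ∈ gKg⁻¹ ↔ g⁻¹xg ∈ K`), `map_conj_one`;
* `Level.ofSmall K … : Level V` — the level `(U(L⁺) ∩ K, K)` of ANY compact open `K ≤ K_f(n𝓞_L)`, `3 ≤ n`
  (neutral component; torsion-free by the tree's `UnitaryGroup.torsionFree_arithmeticLevel`);
* `Level.principal V n hn : Level V` — the principal level `(Γ(n), K_f(n𝓞_L))` itself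
  (`principal_Γ : … = principalCongruenceSubgroup …`);
* **`Level.conjOfSmall K … g : Level V`** — the level `(U(L⁺) ∩ gKg⁻¹, gKg⁻¹)` for every `g ∈ U(V₃,h)(𝔸_{L⁺,f})`
  (`mem_conjOfSmall_K_iff : x ∈ (…).K ↔ g⁻¹ * x * g ∈ K`, `conjOfSmall_one`), and `Level.conj Γ₀ … g` for a level
  `Γ₀` with `Γ₀.K ≤ K_f(n𝓞_L)`;
* `Level.exists_K_conj_iff` — x1's `level_conj` shape: `∀ n ≥ 3, ∀ g, ∀ K ≤ K_f(n𝓞_L)` compact open,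
  `∃ Γ : Level V, ∀ x, x ∈ Γ.K ↔ g⁻¹ * x * g ∈ K`; `Level.exists_le_K_le_principal` — every level has a sub-level
  inside `K_f(n𝓞_L)` ("`K` sufficiently small");
* §4 `Level.exists_component_levels` — representatives `g_q` of `Ξ_K = U(L⁺)\U(𝔸_{L⁺,f})/K` and levels `Λ q` with
  `(Λ q).K = g_qKg_q⁻¹`, `(Λ q).Γ = Γ(g_qKg_q⁻¹)` = the groups of the pieces of the tree's dissection
  `UnitaryGroup.shimuraSetHomeomorph : Sh_K(ℂ) ≃ₜ Σ q, Δ(Γ(g_qKg_q⁻¹))\𝔹²` (`AdelicDoubleQuotientDissection`);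
  `Level.finite_componentIndex` — `Ξ_K` is finite for `V` anisotropic (`UnitaryGroup.finite_shimuraIndex`).

Theorems and structure-valued `def`s only (constructors of the existing structure `Level`; no `Prop`-valued
definition, no named fact, no instance).
-/

noncomputable section

open NumberField IsDedekindDomain

namespace Summit.HodgeConjecture.CorCM

open Literature.NumberTheory.Automorphic
open Literature.AlgebraicGeometry.ShimuraVarieties (principalCongruenceSubgroup hermForm)

/-! ### §0. Conjugates of compact open subgroups -/

section Conj

variable {G : Type*} [Group G]

/-- Membership in the conjugate subgroup `gKg⁻¹ = K.map (MulAut.conj g)`: `x ∈ gKg⁻¹ ↔ g⁻¹xg ∈ K`. -/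
theorem mem_map_conj_iff (K : Subgroup G) (g x : G) : x ∈ K.map (MulAut.conj g).toMonoidHom ↔ g⁻¹ * x * g ∈ K := by
  rw [Subgroup.mem_map_equiv, MulAut.conj_symm_apply]

/-- Conjugating by `1` does nothing. -/
theorem map_conj_one (K : Subgroup G) : K.map (MulAut.conj (1 : G)).toMonoidHom = K := by
  ext x
  rw [mem_map_conj_iff, inv_one, one_mul, mul_one]

end Conj

namespace Level

variable {L : CMField} {ι₁ : L →+* ℂ} {V : HermSpace3 L ι₁}

/-- `n𝓞_L ≠ 0` for `3 ≤ n`. -/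
theorem span_natCast_ne_zero {n : ℕ} (hn : 3 ≤ n) : (Ideal.span {((n : ℕ) : 𝓞 L)} : Ideal (𝓞 L)) ≠ 0 := by
  rw [Ne, Ideal.zero_eq_bot, Ideal.span_singleton_eq_bot]
  exact_mod_cast (show n ≠ 0 by omega)

/-! ### §1. Small compact opens are levels (neutral component) -/

/-- **The level of a small compact open.**  For a compact open `K ≤ K_f(n𝓞_L) ≤ U(V₃,h)(𝔸_{L⁺,f})` with `3 ≤ n`, the
pair `(U(V₃,h)(L⁺) ∩ K, K)` is a `Level V`: the arithmetic group is torsion-free by Minkowski's lemma (tree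
`UnitaryGroup.torsionFree_arithmeticLevel`).  This is the level of the NEUTRAL component `Γ_1\𝔹²` of `Sh_K(ℂ)`. -/
def ofSmall (K : Subgroup V.adelicFin) (hc : IsCompact (K : Set V.adelicFin)) (ho : IsOpen (K : Set V.adelicFin))
    {n : ℕ} (hn : 3 ≤ n)
    (hK : K ≤ UnitaryGroup.finCongruenceLevel (↥(maximalRealSubfield L)) L (IsCMField.complexConj L) 3 V.Hm
      (Ideal.span {(n : 𝓞 L)})) : Level V where
  Γ := UnitaryGroup.arithmeticLevel (↥(maximalRealSubfield L)) L (IsCMField.complexConj L) 3 V.Hm K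
  K := K
  isCompact_K := hc
  isOpen_K := ho
  arithmeticLevel_K := rfl
  torsionFree := UnitaryGroup.torsionFree_arithmeticLevel hn hK

/-- (definitional) -/
@[simp] theorem ofSmall_K (K : Subgroup V.adelicFin) (hc : IsCompact (K : Set V.adelicFin))
    (ho : IsOpen (K : Set V.adelicFin)) {n : ℕ} (hn : 3 ≤ n)
    (hK : K ≤ UnitaryGroup.finCongruenceLevel (↥(maximalRealSubfield L)) L (IsCMField.complexConj L) 3 V.Hm
      (Ideal.span {(n : 𝓞 L)})) : (ofSmall K hc ho hn hK).K = K := rfl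

/-- (definitional) -/
theorem ofSmall_Γ (K : Subgroup V.adelicFin) (hc : IsCompact (K : Set V.adelicFin))
    (ho : IsOpen (K : Set V.adelicFin)) {n : ℕ} (hn : 3 ≤ n)
    (hK : K ≤ UnitaryGroup.finCongruenceLevel (↥(maximalRealSubfield L)) L (IsCMField.complexConj L) 3 V.Hm
      (Ideal.span {(n : 𝓞 L)})) :
    (ofSmall K hc ho hn hK).Γ =
      UnitaryGroup.arithmeticLevel (↥(maximalRealSubfield L)) L (IsCMField.complexConj L) 3 V.Hm K := rfl

/-- **The principal level `(Γ(n), K_f(n𝓞_L))`**, `3 ≤ n` (the level used by `CorCM/Geometry/NonVacuity.lean`). -/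
def principal (V : HermSpace3 L ι₁) (n : ℕ) (hn : 3 ≤ n) : Level V :=
  ofSmall (UnitaryGroup.finCongruenceLevel (↥(maximalRealSubfield L)) L (IsCMField.complexConj L) 3 V.Hm
      (Ideal.span {(n : 𝓞 L)}))
    (UnitaryGroup.isCompact_finCongruenceLevel (↥(maximalRealSubfield L)) L (IsCMField.complexConj L) 3 V.Hm
      (span_natCast_ne_zero hn))
    (UnitaryGroup.isOpen_finCongruenceLevel (↥(maximalRealSubfield L)) L (IsCMField.complexConj L) 3 V.Hm
      (span_natCast_ne_zero hn))
    hn le_rfl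

/-- (definitional) -/
@[simp] theorem principal_K (V : HermSpace3 L ι₁) (n : ℕ) (hn : 3 ≤ n) :
    (principal V n hn).K =
      UnitaryGroup.finCongruenceLevel (↥(maximalRealSubfield L)) L (IsCMField.complexConj L) 3 V.Hm
        (Ideal.span {(n : 𝓞 L)}) := rfl

/-- The arithmetic group of the principal level is the classical principal congruence subgroup `Γ(n)` of the ball
quotient datum (tree `UnitaryGroup.arithmeticLevel_finCongruenceLevel_span`). -/
theorem principal_Γ (V : HermSpace3 L ι₁) (n : ℕ) (hn : 3 ≤ n) :
    (principal V n hn).Γ = principalCongruenceSubgroup (cmConjRingHom L) V.Hm n := by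
  change UnitaryGroup.arithmeticLevel (↥(maximalRealSubfield L)) L (IsCMField.complexConj L) 3 V.Hm _ = _
  rw [UnitaryGroup.arithmeticLevel_finCongruenceLevel_span (by omega : n ≠ 0)]
  rfl

/-- **"`K` sufficiently small"**: every level has a sub-level whose compact open lies in `K_f(n𝓞_L)` (its meet with
the principal level). -/
theorem exists_le_K_le_principal (Γ₀ : Level V) (n : ℕ) (hn : 3 ≤ n) :
    ∃ Γ₁ : Level V, Γ₁ ≤ Γ₀ ∧ Γ₁.K ≤
      UnitaryGroup.finCongruenceLevel (↥(maximalRealSubfield L)) L (IsCMField.complexConj L) 3 V.Hm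
        (Ideal.span {(n : 𝓞 L)}) :=
  ⟨Γ₀ ⊓ principal V n hn, inf_le_left, (inf_le_right : (Γ₀ ⊓ principal V n hn).K ≤ (principal V n hn).K)⟩

/-! ### §2. Conjugate levels: the components `Γ_g\𝔹²` -/

/-- **The conjugate level of a small compact open.**  For a compact open `K ≤ K_f(n𝓞_L)`, `3 ≤ n`, and ANY
`g ∈ U(V₃,h)(𝔸_{L⁺,f})`, the pair `(U(V₃,h)(L⁺) ∩ gKg⁻¹, gKg⁻¹)` is a `Level V`: `gKg⁻¹` is compact open, and the
arithmetic group `Γ_g` is torsion-free (Literature `UnitaryGroup.isCompact_isOpen_torsionFree_map_conj`, Minkowski).  These are the levels of the components of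
`Sh_K(ℂ) = ⊔_g Γ_g\𝔹²` [Milne 2005, Lemma 5.13; Getz–Hahn 2024, (15.2)]. -/
def conjOfSmall (K : Subgroup V.adelicFin) (hc : IsCompact (K : Set V.adelicFin)) (ho : IsOpen (K : Set V.adelicFin))
    {n : ℕ} (hn : 3 ≤ n)
    (hK : K ≤ UnitaryGroup.finCongruenceLevel (↥(maximalRealSubfield L)) L (IsCMField.complexConj L) 3 V.Hm
      (Ideal.span {(n : 𝓞 L)})) (g : V.adelicFin) : Level V where
  Γ := UnitaryGroup.arithmeticLevel (↥(maximalRealSubfield L)) L (IsCMField.complexConj L) 3 V.Hm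
    (K.map (MulAut.conj g).toMonoidHom)
  K := K.map (MulAut.conj g).toMonoidHom
  isCompact_K := (UnitaryGroup.isCompact_isOpen_torsionFree_map_conj hc ho hn hK g).1
  isOpen_K := (UnitaryGroup.isCompact_isOpen_torsionFree_map_conj hc ho hn hK g).2.1
  arithmeticLevel_K := rfl
  torsionFree := (UnitaryGroup.isCompact_isOpen_torsionFree_map_conj hc ho hn hK g).2.2

/-- (definitional) -/
theorem conjOfSmall_K (K : Subgroup V.adelicFin) (hc : IsCompact (K : Set V.adelicFin))
    (ho : IsOpen (K : Set V.adelicFin)) {n : ℕ} (hn : 3 ≤ n)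
    (hK : K ≤ UnitaryGroup.finCongruenceLevel (↥(maximalRealSubfield L)) L (IsCMField.complexConj L) 3 V.Hm
      (Ideal.span {(n : 𝓞 L)})) (g : V.adelicFin) :
    (conjOfSmall K hc ho hn hK g).K = K.map (MulAut.conj g).toMonoidHom := rfl

/-- **The compact open of the conjugate level is `gKg⁻¹`**: `x ∈ (conjOfSmall K … g).K ↔ g⁻¹ x g ∈ K`. -/
theorem mem_conjOfSmall_K_iff (K : Subgroup V.adelicFin) (hc : IsCompact (K : Set V.adelicFin))
    (ho : IsOpen (K : Set V.adelicFin)) {n : ℕ} (hn : 3 ≤ n)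
    (hK : K ≤ UnitaryGroup.finCongruenceLevel (↥(maximalRealSubfield L)) L (IsCMField.complexConj L) 3 V.Hm
      (Ideal.span {(n : 𝓞 L)})) (g x : V.adelicFin) :
    x ∈ (conjOfSmall K hc ho hn hK g).K ↔ g⁻¹ * x * g ∈ K :=
  mem_map_conj_iff K g x

/-- The arithmetic group of the conjugate level is `Γ_g = U(V₃,h)(L⁺) ∩ gKg⁻¹`:
`γ ∈ (conjOfSmall K … g).Γ ↔ γ ∈ U(V₃,h)(L⁺) ∧ g⁻¹ γ g ∈ K`. -/
theorem mem_conjOfSmall_Γ_iff (K : Subgroup V.adelicFin) (hc : IsCompact (K : Set V.adelicFin))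
    (ho : IsOpen (K : Set V.adelicFin)) {n : ℕ} (hn : 3 ≤ n)
    (hK : K ≤ UnitaryGroup.finCongruenceLevel (↥(maximalRealSubfield L)) L (IsCMField.complexConj L) 3 V.Hm
      (Ideal.span {(n : 𝓞 L)})) (g : V.adelicFin) (γ : GL (Fin 3) L) :
    γ ∈ (conjOfSmall K hc ho hn hK g).Γ ↔
      ∃ hγ : γ ∈ UnitaryGroup.rational (↥(maximalRealSubfield L)) L (IsCMField.complexConj L) 3 V.Hm,
        g⁻¹ * UnitaryGroup.rationalToFinAdelic (↥(maximalRealSubfield L)) L (IsCMField.complexConj L) 3 V.Hm ⟨γ, hγ⟩ * g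
          ∈ K := by
  change γ ∈ UnitaryGroup.arithmeticLevel (↥(maximalRealSubfield L)) L (IsCMField.complexConj L) 3 V.Hm _ ↔ _
  rw [UnitaryGroup.mem_arithmeticLevel_iff]
  exact exists_congr fun _ => mem_map_conj_iff K g _

/-- Conjugating by `1` gives the neutral level `ofSmall`. -/
theorem conjOfSmall_one (K : Subgroup V.adelicFin) (hc : IsCompact (K : Set V.adelicFin))
    (ho : IsOpen (K : Set V.adelicFin)) {n : ℕ} (hn : 3 ≤ n)
    (hK : K ≤ UnitaryGroup.finCongruenceLevel (↥(maximalRealSubfield L)) L (IsCMField.complexConj L) 3 V.Hm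
      (Ideal.span {(n : 𝓞 L)})) :
    conjOfSmall K hc ho hn hK 1 = ofSmall K hc ho hn hK :=
  Level.ext (map_conj_one K)

/-- **Conjugating a level.**  For a level `Γ₀` with `Γ₀.K ≤ K_f(n𝓞_L)`, `3 ≤ n`, and `g ∈ U(V₃,h)(𝔸_{L⁺,f})`: the
level `(U(L⁺) ∩ gΓ₀.Kg⁻¹, gΓ₀.Kg⁻¹)`. -/
def conj (Γ₀ : Level V) {n : ℕ} (hn : 3 ≤ n)
    (h : Γ₀.K ≤ UnitaryGroup.finCongruenceLevel (↥(maximalRealSubfield L)) L (IsCMField.complexConj L) 3 V.Hm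
      (Ideal.span {(n : 𝓞 L)})) (g : V.adelicFin) : Level V :=
  conjOfSmall Γ₀.K Γ₀.isCompact_K Γ₀.isOpen_K hn h g

/-- `x ∈ (Γ₀.conj … g).K ↔ g⁻¹ x g ∈ Γ₀.K`. -/
theorem mem_conj_K_iff (Γ₀ : Level V) {n : ℕ} (hn : 3 ≤ n)
    (h : Γ₀.K ≤ UnitaryGroup.finCongruenceLevel (↥(maximalRealSubfield L)) L (IsCMField.complexConj L) 3 V.Hm
      (Ideal.span {(n : 𝓞 L)})) (g x : V.adelicFin) :
    x ∈ (Γ₀.conj hn h g).K ↔ g⁻¹ * x * g ∈ Γ₀.K :=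
  mem_map_conj_iff Γ₀.K g x

/-- `Γ₀.conj … 1 = Γ₀`. -/
theorem conj_one (Γ₀ : Level V) {n : ℕ} (hn : 3 ≤ n)
    (h : Γ₀.K ≤ UnitaryGroup.finCongruenceLevel (↥(maximalRealSubfield L)) L (IsCMField.complexConj L) 3 V.Hm
      (Ideal.span {(n : 𝓞 L)})) : Γ₀.conj hn h 1 = Γ₀ :=
  Level.ext (map_conj_one Γ₀.K)

/-! ### §3. Existence statements in the shape the item-(vi) pin consumes -/

/-- **Component levels exist** (the `level_conj` clause of the stage-1 pin `Thm418PinG`, now a theorem): for every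
`n ≥ 3`, every compact open `K ≤ K_f(n𝓞_L)` and every `g ∈ U(V₃,h)(𝔸_{L⁺,f})` there is a level `Γ : Level V` whose
compact open is `gKg⁻¹`. -/
theorem exists_K_conj_iff {n : ℕ} (hn : 3 ≤ n) (K : Subgroup V.adelicFin) (hc : IsCompact (K : Set V.adelicFin))
    (ho : IsOpen (K : Set V.adelicFin))
    (hK : K ≤ UnitaryGroup.finCongruenceLevel (↥(maximalRealSubfield L)) L (IsCMField.complexConj L) 3 V.Hm
      (Ideal.span {(n : 𝓞 L)})) (g : V.adelicFin) :
    ∃ Γ : Level V, ∀ x : V.adelicFin, x ∈ Γ.K ↔ g⁻¹ * x * g ∈ K :=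
  ⟨conjOfSmall K hc ho hn hK g, mem_conjOfSmall_K_iff K hc ho hn hK g⟩

/-- **Component levels below any level**: for every level `Γ₀`, every `n ≥ 3` and every `g`, the conjugate
`g(Γ₀.K ∩ K_f(n𝓞_L))g⁻¹` is the compact open of a level. -/
theorem exists_K_conj_inf_principal_iff (Γ₀ : Level V) {n : ℕ} (hn : 3 ≤ n) (g : V.adelicFin) :
    ∃ Γ : Level V, ∀ x : V.adelicFin, x ∈ Γ.K ↔ g⁻¹ * x * g ∈ Γ₀.K ⊓ (principal V n hn).K :=
  ⟨(Γ₀ ⊓ principal V n hn).conj hn inf_le_right g, mem_conj_K_iff _ hn _ g⟩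


/-! ### §4. The component levels of the dissection `Sh_K(ℂ) ≃ₜ ⨆_q Γ_{g_q}\𝔹²` -/

/-- **The component levels of `Sh_K(ℂ)`.**  For a compact open `K ≤ K_f(n𝓞_L)`, `3 ≤ n`, there are representatives
`g_q ∈ U(V₃,h)(𝔸_{L⁺,f})` of the index set `Ξ_K = U(V₃,h)(L⁺) \ U(V₃,h)(𝔸_{L⁺,f}) / K` of the tree's dissection
`UnitaryGroup.shimuraSetHomeomorph : Sh_K(ℂ) ≃ₜ Σ q, Δ(Γ(g_qKg_q⁻¹))\𝔹²` (`AdelicDoubleQuotientDissection`, Milne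
Lemma 5.13) and a family of LEVELS `Λ q : Level V` with `(Λ q).K = g_qKg_q⁻¹` and `(Λ q).Γ = Γ(g_qKg_q⁻¹)` — the
arithmetic groups of the pieces, literally.  (This is the `Comp K`, `level`, `level_conj` data of the stage-1 pin
`Thm418PinG`, as a theorem.) -/
theorem exists_component_levels (K : Subgroup V.adelicFin) (hc : IsCompact (K : Set V.adelicFin))
    (ho : IsOpen (K : Set V.adelicFin)) {n : ℕ} (hn : 3 ≤ n)
    (hK : K ≤ UnitaryGroup.finCongruenceLevel (↥(maximalRealSubfield L)) L (IsCMField.complexConj L) 3 V.Hm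
      (Ideal.span {(n : 𝓞 L)})) :
    ∃ (g : MulAction.orbitRel.Quotient
            (↥(UnitaryGroup.rational (↥(maximalRealSubfield L)) L (IsCMField.complexConj L) 3 V.Hm))
            (ShimuraDissection.CosetSpace
              (UnitaryGroup.rationalToFinAdelic (↥(maximalRealSubfield L)) L (IsCMField.complexConj L) 3 V.Hm) K) →
          V.adelicFin)
      (Λ : MulAction.orbitRel.Quotient
            (↥(UnitaryGroup.rational (↥(maximalRealSubfield L)) L (IsCMField.complexConj L) 3 V.Hm))
            (ShimuraDissection.CosetSpace
              (UnitaryGroup.rationalToFinAdelic (↥(maximalRealSubfield L)) L (IsCMField.complexConj L) 3 V.Hm) K) →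
          Level V),
      (∀ q, Quotient.mk'' (ShimuraDissection.CosetSpace.pt
          (UnitaryGroup.rationalToFinAdelic (↥(maximalRealSubfield L)) L (IsCMField.complexConj L) 3 V.Hm) K (g q)) =
        q) ∧
      ∀ q, (Λ q).K = K.map (MulAut.conj (g q)).toMonoidHom ∧
        (Λ q).Γ = UnitaryGroup.arithmeticLevel (↥(maximalRealSubfield L)) L (IsCMField.complexConj L) 3 V.Hm
          (K.map (MulAut.conj (g q)).toMonoidHom) := by
  obtain ⟨g, hg⟩ := UnitaryGroup.exists_representatives_finAdelic (L := L) (H := V.Hm) K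
  exact ⟨g, fun q => conjOfSmall K hc ho hn hK (g q), hg, fun q => ⟨rfl, rfl⟩⟩

/-- **Finitely many components** for an ANISOTROPIC `(V₃,h)` (every `V` over a CM field of degree `> 2`:
`HermSpace3.isAnisotropic_of_two_lt`, `Transposition/Item3EmbOf.lean`) and `K` open: the index set `Ξ_K` is finite
(tree `UnitaryGroup.finite_shimuraIndex`: Godement compactness + Getz–Hahn Thm 2.6.1; Milne Lemma 5.12). -/
theorem finite_componentIndex (hanis : ∀ v : Fin 3 → L, hermForm (cmConjRingHom L) V.Hm v v = 0 → v = 0)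
    (K : Subgroup V.adelicFin) (ho : IsOpen (K : Set V.adelicFin)) :
    Finite (MulAction.orbitRel.Quotient
      (↥(UnitaryGroup.rational (↥(maximalRealSubfield L)) L (IsCMField.complexConj L) 3 V.Hm))
      (ShimuraDissection.CosetSpace
        (UnitaryGroup.rationalToFinAdelic (↥(maximalRealSubfield L)) L (IsCMField.complexConj L) 3 V.Hm) K)) :=
  UnitaryGroup.finite_shimuraIndex L 3 V.Hm hanis K ho

end Level

end Summit.HodgeConjecture.CorCM

end
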